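import Literature.Geometry.Lorentzian.KerrSchildMultiplierEnergyIdentity

/-!
# Crux `AdiabaticMultiKerrILED` (line `Sketch`) — far-field transport: regularity and constants

Helper file for the far-field Morawetz transport stub `stub_farTransport` of the line `Sketch`
(crux item `stmt-FinalStateConjecture-14310`, route `ClusterCompleteness`):

* `continuous_multiplierBulk_of_contDiff`, `continuous_waveOperator_of_contDiff` : continuity of the
  bulk term `K^X` and of the divergence-form wave operator for `C¹` coefficients;
* `far_constant_bookkeeping` : the `ℝ≥0∞` bookkeeping `c₀ F ≤ 2C_b S + C_e Z ⇒ F + Z ≤ C (S + Z)`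
  with `C = 2C_b/c₀ + C_e/c₀ + 1` (registered sub-goal).
-/

noncomputable section

set_option linter.dupNamespace false

open scoped ContDiff Topology ENNReal
open Filter Set MeasureTheory Literature.Geometry.Lorentzian Literature.Geometry.Lorentzian.KerrSchild

namespace Summit.FinalStateConjecture.FinalStateConjecture.Cruxes.AdiabaticMultiKerrILED.Sketch

/-! ### Regularity of the far-field objects -/

/-- The bulk term `K^X` of `C¹` coefficients `G`, a `C¹` multiplier `X` and a `C²` function `w` is
continuous. [folklore] -/
theorem continuous_multiplierBulk_of_contDiff {G : E4 → Fin 4 → Fin 4 → ℝ} {X : E4 → Fin 4 → ℝ}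
    {w : E4 → ℝ} (hG : ∀ μ ν, ContDiff ℝ 1 fun x ↦ G x μ ν) (hX : ∀ α, ContDiff ℝ 1 fun x ↦ X x α)
    (hw : ContDiff ℝ 2 w) : Continuous (multiplierBulk G X w) := by
  have hp : ∀ κ, Continuous fun x ↦ fderiv ℝ w x (E4.basisVector κ) := fun κ ↦
    (hw.continuous_fderiv two_ne_zero).clm_apply continuous_const
  have hdX : ∀ β μ, Continuous fun x ↦ fderiv ℝ (fun y ↦ X y β) x (E4.basisVector μ) := fun β μ ↦
    ((hX β).continuous_fderiv one_ne_zero).clm_apply continuous_const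
  have hdG : ∀ α β μ, Continuous fun x ↦ fderiv ℝ (fun y ↦ G y α β) x (E4.basisVector μ) :=
    fun α β μ ↦ ((hG α β).continuous_fderiv one_ne_zero).clm_apply continuous_const
  have hGc : ∀ μ ν, Continuous fun x ↦ G x μ ν := fun μ ν ↦ (hG μ ν).continuous
  have hXc : ∀ α, Continuous fun x ↦ X x α := fun α ↦ (hX α).continuous
  unfold multiplierBulk
  exact ((continuous_finsetSum _ fun μ _ ↦ (continuous_finsetSum _ fun ν _ ↦ (hGc μ ν).mul (hp ν)).mul
    (continuous_finsetSum _ fun β _ ↦ (hdX β μ).mul (hp β))).sub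
    ((continuous_const.mul (continuous_finsetSum _ fun μ _ ↦ hdX μ μ)).mul
      (continuous_finsetSum _ fun α _ ↦ continuous_finsetSum _ fun β _ ↦
        ((hGc α β).mul (hp α)).mul (hp β)))).sub
    (continuous_const.mul (continuous_finsetSum _ fun μ _ ↦ (hXc μ).mul
      (continuous_finsetSum _ fun α _ ↦ continuous_finsetSum _ fun β _ ↦
        ((hdG α β μ).mul (hp α)).mul (hp β))))

/-- The divergence-form wave operator of `C¹` coefficients applied to a `C²` function is
continuous. [folklore] -/
theorem continuous_waveOperator_of_contDiff {G : E4 → Fin 4 → Fin 4 → ℝ} {w : E4 → ℝ}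
    (hG : ∀ μ ν, ContDiff ℝ 1 fun x ↦ G x μ ν) (hw : ContDiff ℝ 2 w) :
    Continuous (waveOperator G w) := by
  have hp : ∀ ν, ContDiff ℝ 1 fun x ↦ fderiv ℝ w x (E4.basisVector ν) := fun ν ↦
    contDiff_fderiv_apply_basisVector hw ν
  have hA : ∀ μ, ContDiff ℝ 1 fun y ↦ ∑ ν, G y μ ν * fderiv ℝ w y (E4.basisVector ν) := fun μ ↦
    ContDiff.sum fun ν _ ↦ (hG μ ν).mul (hp ν)
  change Continuous fun x ↦
    ∑ μ, fderiv ℝ (fun y ↦ ∑ ν, G y μ ν * fderiv ℝ w y (E4.basisVector ν)) x (E4.basisVector μ)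
  exact continuous_finsetSum _ fun μ _ ↦
    ((hA μ).continuous_fderiv one_ne_zero).clm_apply continuous_const

/-! ### Bookkeeping of the constants in `ℝ≥0∞` -/

/-- If `c₀ F ≤ 2 C_b S + C_e Z` then `F + Z ≤ (2C_b/c₀ + C_e/c₀ + 1)(S + Z)` in `ℝ≥0∞`. [folklore] -/
theorem far_constant_bookkeeping {c₀ Cb Ce : ℝ} (hc₀ : 0 < c₀) (hCb : 0 ≤ Cb) (hCe : 0 ≤ Ce)
    {F S Z : ℝ≥0∞}
    (hF : ENNReal.ofReal c₀ * F ≤ 2 * ENNReal.ofReal Cb * S + ENNReal.ofReal Ce * Z) :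
    F + Z ≤ ENNReal.ofReal (2 * Cb / c₀ + Ce / c₀ + 1) * (S + Z) := by
  have hinv : 0 ≤ c₀⁻¹ := inv_nonneg.mpr hc₀.le
  have hF' : F ≤ ENNReal.ofReal c₀⁻¹ * (2 * ENNReal.ofReal Cb * S + ENNReal.ofReal Ce * Z) := by
    calc F = ENNReal.ofReal c₀⁻¹ * (ENNReal.ofReal c₀ * F) := by
          rw [← mul_assoc, ← ENNReal.ofReal_mul hinv, inv_mul_cancel₀ hc₀.ne', ENNReal.ofReal_one,
            one_mul]
      _ ≤ _ := mul_le_mul' le_rfl hF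
  have hk1 : ENNReal.ofReal c₀⁻¹ * (2 * ENNReal.ofReal Cb) ≤ ENNReal.ofReal (2 * Cb / c₀ + Ce / c₀ + 1) := by
    have : ENNReal.ofReal c₀⁻¹ * (2 * ENNReal.ofReal Cb) = ENNReal.ofReal (c₀⁻¹ * (2 * Cb)) := by
      rw [ENNReal.ofReal_mul hinv, ENNReal.ofReal_mul zero_le_two, ENNReal.ofReal_ofNat]
    rw [this]
    refine ENNReal.ofReal_le_ofReal ?_
    have h1 : c₀⁻¹ * (2 * Cb) = 2 * Cb / c₀ := by field_simp
    have h2 : 0 ≤ Ce / c₀ := div_nonneg hCe hc₀.le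
    linarith
  have hk2 : ENNReal.ofReal c₀⁻¹ * ENNReal.ofReal Ce + 1 ≤ ENNReal.ofReal (2 * Cb / c₀ + Ce / c₀ + 1) := by
    have : ENNReal.ofReal c₀⁻¹ * ENNReal.ofReal Ce + 1 = ENNReal.ofReal (c₀⁻¹ * Ce + 1) := by
      rw [ENNReal.ofReal_add (mul_nonneg hinv hCe) zero_le_one, ENNReal.ofReal_mul hinv,
        ENNReal.ofReal_one]
    rw [this]
    refine ENNReal.ofReal_le_ofReal ?_
    have h1 : c₀⁻¹ * Ce = Ce / c₀ := by field_simp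
    have h2 : 0 ≤ 2 * Cb / c₀ := div_nonneg (by linarith) hc₀.le
    linarith
  calc F + Z ≤ ENNReal.ofReal c₀⁻¹ * (2 * ENNReal.ofReal Cb * S + ENNReal.ofReal Ce * Z) + Z :=
        add_le_add hF' le_rfl
    _ = ENNReal.ofReal c₀⁻¹ * (2 * ENNReal.ofReal Cb) * S + (ENNReal.ofReal c₀⁻¹ * ENNReal.ofReal Ce + 1) * Z := by
        ring
    _ ≤ ENNReal.ofReal (2 * Cb / c₀ + Ce / c₀ + 1) * S + ENNReal.ofReal (2 * Cb / c₀ + Ce / c₀ + 1) * Z :=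
        add_le_add (mul_le_mul' hk1 le_rfl) (mul_le_mul' hk2 le_rfl)
    _ = ENNReal.ofReal (2 * Cb / c₀ + Ce / c₀ + 1) * (S + Z) := (mul_add _ _ _).symm

end Summit.FinalStateConjecture.FinalStateConjecture.Cruxes.AdiabaticMultiKerrILED.Sketch

end
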